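/-
Origin: expansion seat `prover-pub-hodgecm-mc-binder-2-g12-0`, handover #61 2026-08-20T06:35Z md5 c52488b56620 (110 l.; CERTIFIED same mirror: rc 0 / 0 err / 0 warn / 60 s; `#print axioms` of mem_pinIsotypicPolys_iff_of_hκ · archSK_eq_closure_span_det ⊆ trio (`g12/certs/axioms-61.log`); imports #59 `DensePin` only; (J-dense) UNDER THE (V-val) IDENTITY `hκ` THE ISOTYPIC POLYNOMIALS ARE η-FREE AND κ-FREE: **`detIsotypicPolys V S`** := homogeneous `G` on `Fin 6 × places` with `linSubst (star (letterBlockOf (kVLetters (lett k)))) G = dVIota V S (lett V S k (cmPlace ι₁)) • G` for all `k ∈ K_∞` (invariance under the compact V-letters off ι₁, det-covariance through #46's `dVIota` at ι₁; NO η, μ, archKappa), `mem_detIsotypicPolys` (Iff.rfl), `smul_eq_smul_iff_of_mul_eq` (scalar bookkeeping `c·d = κ ≠ 0 ⇒ (c•X = κ•G ↔ X = d•G)`), **`mem_pinIsotypicPolys_iff_of_hκ : (hκ of #51, verbatim) → (G ∈ pinIsotypicPolys V S hGR η hW ↔ G ∈ detIsotypicPolys V S)`**, **`archSK_eq_closure_span_det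 : hκ → archSK = closure (span (follandFock cmBigFrame '' detIsotypicPolys))`**; CONSEQUENCE: given `hκ` (already a rows-18/19 residual), #60's `hpoly` is the classical-invariant-theory statement about `detIsotypicPolys` vs the inserted printed span — (J-dense)(iv) needs no value of E's η/μ/κ; 0 Prop-defs / 0 records / 0 proof-hole-class tokens; FQN scan: 0 collisions; NAME LIST `HodgeCM.Model.HypCensus.mem_pinIsotypicPolys_iff_of_hκ` · `HodgeCM.Model.HypCensus.detIsotypicPolys` · `HodgeCM.Model.HypCensus.archSK_eq_closure_span_det`) (`HOME/mc/pub-hodgecm-mc-binder-2/g12/pkg/HodgeCM/Model/HypCensus/DenseLetters.lean`, md5 c52488b56620, 110 lines);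
landed by the gen-16 packager (p-g16) in gate run 43 as `HodgeCM/Model/HypCensus/DenseLetters.lean` (verbatim).
-/
/-
Copyright (c) 2026. All rights reserved.
Released under Apache 2.0 license as described in the file LICENSE.
-/
import Summits.HodgeConjecture.HodgeCM.Model.HypCensus.DensePin

/-!
# (J-dense): under the (V-val) identity `hκ` the isotypic polynomials of the pin are `η`-FREE and `κ`-FREE

Binder-2 lineage, rows 18/19 (`hyp12`/`hyp34`), field `dense` of `HypCoreW`.

`pinIsotypicPolys` (#59) is cut out by `(η(kPair k) · pinLetterChar (letters k)) • (G ∘ letters(k)⁻¹) = archKappa k • G`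
for all `k ∈ K_∞`.  Under the ONE identity `hκ : η(kPair k) · pinLetterChar (letters k) · dVIota (lett k v₁) = archKappa k`
(the (V-val) residual of #51, already a hypothesis of rows 18/19) this is equivalent to the character-free condition

  `G ∘ letters(k)⁻¹ = dVIota (lett k v₁) • G`  for all `k ∈ K_∞`

(`mem_pinIsotypicPolys_iff_of_hκ`): invariance under the compact `V`-letters at every place `w ≠ v₁` and `det`-covariance
(through `dVIota`) at `v₁ = w(ι₁)` — a statement about polynomial invariants of `Π_w U(V⁺_w) × U(V⁻_w)` alone, with no
reference to E's `η`, `μ` or `κ`.  So the residual `hpoly` of #60 is, given `hκ`, the classical-invariant-theory statement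
`detIsotypicPolys ⊆ …` about `detIsotypicPolys` below.
[folklore]
-/

noncomputable section

open NumberField NumberField.InfinitePlace IsDedekindDomain
open scoped Matrix Classical TensorProduct
open MvPolynomial
open Literature.NumberTheory.Automorphic Literature.NumberTheory.Automorphic.UnitaryGroup Literature.NumberTheory.Weil1964
open Literature.RepresentationTheory.KonnoKonno2007 Literature.RepresentationTheory.KonnoKonno2007.RealDualPair
open Literature.NumberTheory.GelbartRogawski1991 Literature.NumberTheory.GelbartRogawski1991.UnitaryDualPair
open Literature.Analysis.SegalBargmann
open HodgeCM HodgeCM.Model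

namespace HodgeCM.Model.HypCensus

section Pin

variable {L : CMField} {ι₁ : L →+* ℂ} (V : HermSpace3 L ι₁) (S : StubTree.SeesawDatum L)
variable
  (hGR : (cmSplittingDatum (L : Type) finProdFinEquiv (frameD V) (frameD_real V) (frameD_ne V) (dW S) (dW_real S) (dW_ne S)).CompatibleSplitting)
  (η : CMAdelic (L : Type) (frameD V) × CMAdelic (L : Type) (dW S) →* ℂˣ)
  (hW : (∀ j, 0 < (ι₁ (dW S j)).re) ∨ ∀ j, (ι₁ (dW S j)).re < 0)

/-- **The `det`-isotypic homogeneous polynomials of the pin** (character-free): homogeneous `G` on `Fin 6 × places` with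
`G ∘ letters(k)⁻¹ = dVIota (lett k v₁) • G` for every `k ∈ K_∞`. -/
def detIsotypicPolys : Set (MvPolynomial (Fin 6 × {v : InfinitePlace ↥(maximalRealSubfield L) // v.IsReal}) ℂ) :=
  {G | (∃ d, G.IsHomogeneous d) ∧ ∀ k : ↥(KInfty V),
    linSubst (star ((letterBlockOf (L : Type) (frameD V) (frameD_real V) (dW S) (dW_real S) ι₁
        (kVLetters V S (lett V S k)) : Matrix.unitaryGroup _ ℂ) : Matrix _ _ ℂ)) G =
      dVIota V S (lett V S k (cmPlace (L : Type) ι₁)) • G}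

/-- Membership in `detIsotypicPolys`. -/
theorem mem_detIsotypicPolys {G : MvPolynomial (Fin 6 × {v : InfinitePlace ↥(maximalRealSubfield L) // v.IsReal}) ℂ} :
    G ∈ detIsotypicPolys V S ↔
      (∃ d, G.IsHomogeneous d) ∧ ∀ k : ↥(KInfty V),
        linSubst (star ((letterBlockOf (L : Type) (frameD V) (frameD_real V) (dW S) (dW_real S) ι₁
            (kVLetters V S (lett V S k)) : Matrix.unitaryGroup _ ℂ) : Matrix _ _ ℂ)) G =
          dVIota V S (lett V S k (cmPlace (L : Type) ι₁)) • G :=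
  Iff.rfl

/-- scalar bookkeeping: `c * d = κ ≠ 0` ⇒ (`c • X = κ • G ↔ X = d • G`). -/
theorem smul_eq_smul_iff_of_mul_eq {M : Type*} [AddCommGroup M] [Module ℂ M] {c d κ : ℂ} (hk : c * d = κ) (hκ0 : κ ≠ 0)
    (X G : M) : c • X = κ • G ↔ X = d • G := by
  constructor
  · intro h
    refine smul_right_injective M hκ0 ?_
    dsimp only
    calc κ • X = (d * c) • X := by rw [mul_comm, hk]
      _ = d • (c • X) := mul_smul _ _ _
      _ = d • (κ • G) := by rw [h]
      _ = κ • (d • G) := smul_comm _ _ _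
  · intro h
    rw [h, smul_smul, hk]

/-- **Under `hκ`, `pinIsotypicPolys = detIsotypicPolys`** (membership form). -/
theorem mem_pinIsotypicPolys_iff_of_hκ
    (hκ : ∀ k : ↥(KInfty V),
      ((η (kPair V S ι₁ V.sylvesterFrame (sylvesterFrame_formCongr V) k) : ℂˣ) : ℂ) *
        ((pinLetterChar V S hGR hW (kVLetters V S (lett V S k)) : Circle) : ℂ) * dVIota V S (lett V S k (cmPlace (L : Type) ι₁)) =
      ((UnitaryGroup.archKappa (L : Type) V.Hm ι₁ V.sylvesterFrame (sylvesterFrame_formCongr V) k : ℂˣ) : ℂ))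
    {G : MvPolynomial (Fin 6 × {v : InfinitePlace ↥(maximalRealSubfield L) // v.IsReal}) ℂ} :
    G ∈ pinIsotypicPolys V S hGR η hW ↔ G ∈ detIsotypicPolys V S := by
  rw [mem_pinIsotypicPolys, mem_detIsotypicPolys]
  exact and_congr Iff.rfl (forall_congr' fun k => smul_eq_smul_iff_of_mul_eq (hκ k) (Units.ne_zero _) _ _)

include hW in
/-- **Under `hκ`, `𝒮_∞^κ = closure (span (follandFock 𝔢 '' detIsotypicPolys))`** — the archimedean `κ`-isotypic subspace of
the pin is described WITHOUT `η`, `μ`, `κ`: by the compact `V`-letter invariants with `det`-covariance at `v₁`. -/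
theorem archSK_eq_closure_span_det
    (hκ : ∀ k : ↥(KInfty V),
      ((η (kPair V S ι₁ V.sylvesterFrame (sylvesterFrame_formCongr V) k) : ℂˣ) : ℂ) *
        ((pinLetterChar V S hGR hW (kVLetters V S (lett V S k)) : Circle) : ℂ) * dVIota V S (lett V S k (cmPlace (L : Type) ι₁)) =
      ((UnitaryGroup.archKappa (L : Type) V.Hm ι₁ V.sylvesterFrame (sylvesterFrame_formCongr V) k : ℂˣ) : ℂ)) :
    (archSK V S hGR η ι₁ V.sylvesterFrame (sylvesterFrame_formCongr V) :
        Set (SchwartzMap (Fin 6 → mixedEmbedding.mixedSpace (↥(maximalRealSubfield L))) ℂ)) =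
      closure (Submodule.span ℂ
        ((fun G => follandFock (cmBigFrame (L : Type) finProdFinEquiv (frameD V) (frameD_real V) (frameD_ne V) (dW S)
            (dW_real S) (dW_ne S) ι₁) G) '' detIsotypicPolys V S) :
          Set (SchwartzMap (Fin 6 → mixedEmbedding.mixedSpace (↥(maximalRealSubfield L))) ℂ)) := by
  have hset : pinIsotypicPolys V S hGR η hW = detIsotypicPolys V S :=
    Set.ext fun G => mem_pinIsotypicPolys_iff_of_hκ V S hGR η hW hκ
  rw [archSK_eq_closure_span V S hGR η hW, hset]

end Pin

end HodgeCM.Model.HypCensus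

end
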